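import Summits.Ventures.LatticeQCDFlow.TrivializingMaps.CouplingLadderLawAnyGroup
import Summits.Ventures.LatticeQCDFlow.Scaling.PlaquetteIndependence2D
import Summits.Ventures.LatticeQCDFlow.Scaling.TiltedPiMeasure
import Literature.Probability.LatticeModels.GinibrePositiveKernels
import Literature.Probability.LatticeModels.ONModelProofs

/-!
HONEST FRAMING: exact (Metropolis-corrected) sampling algorithms for lattice gauge theory; figures
of merit are autocorrelation/cost numbers at stated couplings and volumes; no continuum-physics
claim.

# SpecificHeatCeilingTwoDim — IN TWO DIMENSIONS THE SPECIFIC HEAT OF THE WILSON ACTION IS `O(1)` PER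
# PLAQUETTE AT EVERY COUPLING, FOR EVERY COMPACT GAUGE GROUP:
# `Var_{μ_β}(S_W^ρ) ≤ 2N²·e^{2N|β|}·L²` on `(ℤ/L)²`, `L ≥ 2`, every real `β` (lean-2 GEN-12, ours)

Venture-side (OURS).  Cell `lqcd-flow` (pub-lqcd), unit `pub-lqcd-lean-2-g12`, 2026-08-23.  The tree has
specific-heat FLOORS of order the volume at every coupling (`WilsonVarianceFloorAllCouplings`, GEN-9;
theory2's `Scaling/ExtensiveSpecificHeat`, `Scaling/WilsonSpecificHeatFloor`) but NO pointwise CEILING of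
order the volume outside the strong-coupling window (`ReweightingWindowsStrongCoupling`: `32#plaq/r²` on
`|u| ≤ r/4` only; everywhere else only the trivial `(N#plaq)²`, `CouplingLadderLawAnyGroup.wilson_variance_le_sq`),
and none can exist uniformly in the volume at a bulk first-order transition (`SpecificHeatIntegralCeiling`
docstring; theory2 item 131).  In TWO dimensions there is no such obstruction, and this file proves the
ceiling at EVERY coupling for EVERY compact gauge group from lean-1's structural fact
(`Scaling/PlaquetteIndependence2D.map_plaquettes_eq_pi`): under product Haar measure on the links of
`(ℤ/L)²` the plaquette holonomies off one puncture `x₀` are INDEPENDENT and Haar distributed.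

## The argument (all of it elementary measure theory over the tree)

Write `S_W = S' + s₀` with `S' = Σ_{x ≠ x₀} s(U_x)`, `s₀ = s(U_{x₀})`, `s(g) = N − Re tr ρ(g) ∈ [0, 2N]`
(unitary trick, `CompactGroup.abs_re_trace_le_card`).  Let `ν_β ∝ e^{−βS'} D[U]` be the PUNCTURED
Wilson measure.  (i) `μ_β = ν_β.tilted(−β s₀)` (`tilted_tilted`) and `−βs₀` oscillates by at most
`2N|β|`, so `∫ F dμ_β ≤ e^{2N|β|} ∫ F dν_β` for every `F ≥ 0` (`Scaling.integral_tilted_le_exp_osc_mul`).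
(ii) The push-forward of `ν_β` under `U ↦ (U_x)_{x ≠ x₀}` is the PRODUCT of `L² − 1` one-plaquette
tilted Haar measures (the Literature's `map_tilted_comp`, `Scaling.pi_tilted_sum`, lean-1's
`map_plaquettes_eq_pi`), so
`Var_{ν_β}(S') = (L² − 1)·Var_{one plaquette} ≤ (L² − 1)·N²` (Mathlib's `variance_sum_pi`, Popoviciu).
(iii) `Var_{μ_β}(S_W) ≤ E_{μ_β}[(S_W − m − N)²] ≤ 2E_{μ_β}[(S' − m)²] + 2N² ≤ 2e^{2N|β|}(L² − 1)N² + 2N²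
≤ 2N²e^{2N|β|}L²` with `m = E_{ν_β}[S']`.

## What is proved

(The 2-d torus `(ℤ/L)²`, `L ≥ 2`, any compact second-countable `G`, any continuous `ρ : G →* M_N(ℂ)`,
every real `β`; tilted-measure toolkit in `Scaling/TiltedPiMeasure` and the Literature's
`map_tilted_comp`.)
* `wilsonAction_two_eq_sum_sites`, `wilsonAction_two_eq_add_sum_ne` — `S_W = Σ_x s(U_x) = s(U_{x₀}) +
  Σ_{x ≠ x₀} s(U_x)`; `plaqTerm_mem_Icc` — `s ∈ [0, 2N]`;
* `wilsonMeasure_two_eq_tilted_punctured` — (i); `map_punctured_eq_pi` — (ii);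
  `variance_punctured_le` — `Var_{ν_β}(S') ≤ (L² − 1)·N²`;
* **`wilson_variance_le_twoDim`** (MAIN): `Var_{μ_β}(S_W^ρ) ≤ 2N²·exp(2N|β|)·L²`, and
  `wilson_variance_le_twoDim_card`: the same with `L²` written `#plaq((ℤ/L)²)`.

Reading (no numerics implied): in `d = 2` the specific heat per plaquette of the Wilson action is bounded
at every coupling uniformly in the volume, for every compact gauge group — so every coupling-transfer law
of the tree that is two-sided "under a ceiling `M`" (swap / simulated-tempering / overlap floors, ladder
sufficiency, per-step reweighting windows) becomes UNCONDITIONAL and two-sided `Θ(√volume)` in two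
dimensions at every coupling (docked in `CouplingLadderLawTwoDim`).  The constant `e^{2N|β|}` is
structural (one punctured plaquette weight), not sharp: for `U(1)` the exact value is row 5's
`Scoring/U1TorusPlaquetteVarianceFiniteVolume` (`L²·Var(P̄) → 1 − t/β − t²`).
NOT CLAIMED: anything in `d ≥ 3` (plaquettes are not independent there; the ceiling is false uniformly in
`L` at a bulk first-order transition); sharp constants; the continuum.  Literature grade (cell rule): KNOWN
MECHANISM (two-dimensional lattice gauge theory reduces to independent plaquettes up to a global
constraint — Migdal 1975, Gross–Witten 1980), NEW TYPING (finite torus, every compact `G`, every real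
coupling, explicit volume-uniform constant); nothing is cited as a fact.
-/

noncomputable section

open MeasureTheory ProbabilityTheory Real Set
open Literature.MathematicalPhysics.QuantumFieldTheory
open Literature.MathematicalPhysics.QuantumFieldTheory.Luscher2010
open Summit.Ventures.LatticeQCDFlow.Scaling
open Summit.Ventures.LatticeQCDFlow.Theory2.Lattice.TwoDim
open Literature.Probability.LatticeModels (integrable_of_continuous_compactSpace map_tilted_comp)

namespace Summit.Ventures.LatticeQCDFlow.TrivializingMaps

/-! ## §2 The two-dimensional Wilson action: the specific-heat ceiling -/

section TwoDim

variable {L N : ℕ} [NeZero L] {G : Type*} [Group G] [TopologicalSpace G] [IsTopologicalGroup G]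
  [CompactSpace G] [MeasurableSpace G] [BorelSpace G] [SecondCountableTopology G]
  (ρ : G →* Matrix (Fin N) (Fin N) ℂ)

omit [TopologicalSpace G] [IsTopologicalGroup G] [CompactSpace G] [MeasurableSpace G] [BorelSpace G]
  [SecondCountableTopology G] in
/-- In two dimensions the Wilson action is the sum over the SITES of `(ℤ/L)²` of the one-plaquette
actions `N − Re tr ρ(U_x)` of the `(0,1)`-holonomies. [folklore] -/
theorem wilsonAction_two_eq_sum_sites (U : GaugeConfig 2 L G) :
    wilsonAction ρ U = ∑ x : Site 2 L, ((N : ℝ) - (ρ (plaquetteHolonomy U x 0 1)).trace.re) := by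
  unfold wilsonAction
  let e : Plaquette 2 L ≃ Site 2 L :=
    { toFun := fun p => p.1
      invFun := fun x => (x, ⟨((0 : Fin 2), (1 : Fin 2)), by decide⟩)
      left_inv := fun p => Prod.ext rfl (plane_eq_zero_one p.2).symm
      right_inv := fun _ => rfl }
  refine Fintype.sum_equiv e _ _ fun p => ?_
  obtain ⟨x, q⟩ := p
  rw [plane_eq_zero_one q]
  rfl

omit [TopologicalSpace G] [IsTopologicalGroup G] [CompactSpace G] [MeasurableSpace G] [BorelSpace G]
  [SecondCountableTopology G] in
/-- **Puncturing**: `S_W(U) = s(U_{x₀}) + Σ_{x ≠ x₀} s(U_x)` on `(ℤ/L)²`, `s(g) = N − Re tr ρ(g)`. [folklore] -/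
theorem wilsonAction_two_eq_add_sum_ne (x₀ : Site 2 L) (U : GaugeConfig 2 L G) :
    wilsonAction ρ U = ((N : ℝ) - (ρ (plaquetteHolonomy U x₀ 0 1)).trace.re) +
      ∑ i : {x : Site 2 L // x ≠ x₀}, ((N : ℝ) - (ρ (plaquetteHolonomy U i.1 0 1)).trace.re) := by
  classical
  rw [wilsonAction_two_eq_sum_sites ρ U, Fintype.sum_eq_add_sum_compl x₀]
  congr 1
  exact Finset.sum_subtype _ (fun x => by simp [Finset.mem_compl])
    fun x => (N : ℝ) - (ρ (plaquetteHolonomy U x 0 1)).trace.re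

omit [MeasurableSpace G] [BorelSpace G] [SecondCountableTopology G] in
/-- The one-plaquette action takes values in `[0, 2N]` (unitary trick). [folklore] -/
theorem plaqTerm_mem_Icc (hρ : Continuous ρ) (g : G) :
    (N : ℝ) - (ρ g).trace.re ∈ Icc (0 : ℝ) (2 * N) := by
  have h := abs_le.1
    (Literature.RepresentationTheory.CompactGroups.CompactGroup.abs_re_trace_le_card ρ hρ g)
  simp only [Fintype.card_fin] at h
  constructor <;> linarith [h.1, h.2]

omit [IsTopologicalGroup G] [CompactSpace G] [MeasurableSpace G] [BorelSpace G]
  [SecondCountableTopology G] in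
/-- The one-plaquette action is continuous. [folklore] -/
theorem continuous_plaqTerm (hρ : Continuous ρ) :
    Continuous fun g : G => (N : ℝ) - (ρ g).trace.re :=
  continuous_const.sub (Complex.continuous_re.comp hρ.matrix_trace)

omit [NeZero L] [CompactSpace G] [MeasurableSpace G] [BorelSpace G] [SecondCountableTopology G] in
/-- The off-puncture holonomy map `U ↦ (U_x)_{x ≠ x₀}` is continuous. [folklore] -/
theorem continuous_holonomies_ne (x₀ : Site 2 L) :
    Continuous fun (U : GaugeConfig 2 L G) (i : {x : Site 2 L // x ≠ x₀}) =>
      plaquetteHolonomy U i.1 0 1 := by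
  refine continuous_pi fun i => ?_
  unfold plaquetteHolonomy
  fun_prop

/-- **(i) THE WILSON MEASURE IS A BOUNDED TILT OF THE PUNCTURED WILSON MEASURE**:
`μ_β = ν_β.tilted (−β s(U_{x₀}))` with `ν_β = D[U].tilted (−β Σ_{x ≠ x₀} s(U_x))`. [ours] -/
theorem wilsonMeasure_two_eq_tilted_punctured (hρ : Continuous ρ) (x₀ : Site 2 L) (β : ℝ) :
    wilsonMeasure (d := 2) (L := L) ρ β =
      ((trivialMeasure G 2 L).tilted fun U => ∑ i : {x : Site 2 L // x ≠ x₀},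
          -(β * ((N : ℝ) - (ρ (plaquetteHolonomy U i.1 0 1)).trace.re))).tilted
        fun U => -(β * ((N : ℝ) - (ρ (plaquetteHolonomy U x₀ 0 1)).trace.re)) := by
  have hc : Continuous fun U : GaugeConfig 2 L G => ∑ i : {x : Site 2 L // x ≠ x₀},
      -(β * ((N : ℝ) - (ρ (plaquetteHolonomy U i.1 0 1)).trace.re)) := by
    refine continuous_finsetSum _ fun i _ => ?_
    exact (continuous_const.mul ((continuous_plaqTerm ρ hρ).comp
      ((continuous_apply i).comp (continuous_holonomies_ne (G := G) x₀)))).neg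
  rw [wilsonMeasure_eq_tilted_neg ρ hρ β, tilted_tilted
    (integrable_trivialMeasure_of_continuous_group (continuous_exp.comp hc))]
  congr 1
  funext U
  rw [Pi.add_apply, wilsonAction_two_eq_add_sum_ne ρ x₀ U]
  have : ∑ i : {x : Site 2 L // x ≠ x₀}, -(β * ((N : ℝ) - (ρ (plaquetteHolonomy U i.1 0 1)).trace.re))
      = -(β * ∑ i : {x : Site 2 L // x ≠ x₀},
          ((N : ℝ) - (ρ (plaquetteHolonomy U i.1 0 1)).trace.re)) := by
    rw [Finset.mul_sum, ← Finset.sum_neg_distrib]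
  rw [this]
  ring

/-- **(ii) THE PUSH-FORWARD OF THE PUNCTURED WILSON MEASURE UNDER `U ↦ (U_x)_{x ≠ x₀}` IS THE PRODUCT
OF `L² − 1` ONE-PLAQUETTE TILTED HAAR MEASURES** (`L ≥ 2`). [ours] -/
theorem map_punctured_eq_pi (hL : 2 ≤ L) (hρ : Continuous ρ) (x₀ : Site 2 L) (β : ℝ) :
    ((trivialMeasure G 2 L).tilted fun U => ∑ i : {x : Site 2 L // x ≠ x₀},
        -(β * ((N : ℝ) - (ρ (plaquetteHolonomy U i.1 0 1)).trace.re))).map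
      (fun (U : GaugeConfig 2 L G) (i : {x : Site 2 L // x ≠ x₀}) => plaquetteHolonomy U i.1 0 1) =
    Measure.pi fun _ : {x : Site 2 L // x ≠ x₀} =>
      (haarProbability G).tilted fun g => -(β * ((N : ℝ) - (ρ g).trace.re)) := by
  have hΦ : Measurable fun (U : GaugeConfig 2 L G) (i : {x : Site 2 L // x ≠ x₀}) =>
      plaquetteHolonomy U i.1 0 1 :=
    measurable_pi_lambda _ fun i => measurable_plaquetteHolonomy i.1
  have hf : Measurable fun g : G => -(β * ((N : ℝ) - (ρ g).trace.re)) :=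
    (continuous_const.mul (continuous_plaqTerm ρ hρ)).neg.measurable
  have hF : Measurable fun ω : {x : Site 2 L // x ≠ x₀} → G =>
      ∑ i, -(β * ((N : ℝ) - (ρ (ω i)).trace.re)) :=
    Finset.measurable_sum _ fun i _ => hf.comp (measurable_pi_apply i)
  have h := map_tilted_comp (trivialMeasure G 2 L) hΦ hF
  rw [Function.comp_def] at h
  rw [h]
  unfold trivialMeasure
  rw [map_plaquettes_eq_pi hL x₀]
  exact pi_tilted_sum _ (fun _ g => -(β * ((N : ℝ) - (ρ g).trace.re))) fun _ =>
    (BoundedContinuousFunction.mkOfCompact ⟨fun g => exp (-(β * ((N : ℝ) - (ρ g).trace.re))),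
      continuous_exp.comp (continuous_const.mul (continuous_plaqTerm ρ hρ)).neg⟩).integrable _

/-- **THE VARIANCE OF THE PUNCTURED ACTION UNDER THE PUNCTURED WILSON MEASURE IS AT MOST `(L² − 1)·N²`**
(independence of the `L² − 1` off-puncture plaquettes, Popoviciu's bound `Var ≤ N²` for each). [ours] -/
theorem variance_punctured_le (hL : 2 ≤ L) (hρ : Continuous ρ) (x₀ : Site 2 L) (β : ℝ) :
    variance (fun U : GaugeConfig 2 L G => ∑ i : {x : Site 2 L // x ≠ x₀},
        ((N : ℝ) - (ρ (plaquetteHolonomy U i.1 0 1)).trace.re))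
      ((trivialMeasure G 2 L).tilted fun U => ∑ i : {x : Site 2 L // x ≠ x₀},
        -(β * ((N : ℝ) - (ρ (plaquetteHolonomy U i.1 0 1)).trace.re))) ≤
      ((L : ℝ) ^ 2 - 1) * (N : ℝ) ^ 2 := by
  classical
  set s : G → ℝ := fun g => (N : ℝ) - (ρ g).trace.re with hs_def
  set π₁ : Measure G := (haarProbability G).tilted fun g => -(β * s g) with hπ₁
  have hs_cont : Continuous s := continuous_plaqTerm ρ hρ
  have hs_mem : ∀ g, s g ∈ Icc (0 : ℝ) (2 * N) := fun g => plaqTerm_mem_Icc ρ hρ g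
  haveI : IsProbabilityMeasure π₁ := isProbabilityMeasure_tilted
    ((BoundedContinuousFunction.mkOfCompact ⟨fun g => exp (-(β * s g)),
      continuous_exp.comp (continuous_const.mul hs_cont).neg⟩).integrable _)
  let Φ : GaugeConfig 2 L G → ({x : Site 2 L // x ≠ x₀} → G) := fun U i => plaquetteHolonomy U i.1 0 1
  have hΦ : Measurable Φ := measurable_pi_lambda _ fun i => measurable_plaquetteHolonomy i.1
  let T : ({x : Site 2 L // x ≠ x₀} → G) → ℝ := ∑ i, fun ω => s (ω i)
  have hT : ∀ ω, T ω = ∑ i, s (ω i) := fun ω => by simp only [T, Finset.sum_apply]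
  have hTc : Continuous T :=
    (continuous_finsetSum _ fun i _ => hs_cont.comp (continuous_apply i)).congr fun ω => (hT ω).symm
  have hTm : Measurable T := hTc.measurable
  -- the observable is `T ∘ Φ`
  have hobs : (fun U : GaugeConfig 2 L G => ∑ i : {x : Site 2 L // x ≠ x₀},
      ((N : ℝ) - (ρ (plaquetteHolonomy U i.1 0 1)).trace.re)) = T ∘ Φ := by
    funext U; rw [Function.comp_apply, hT]
  rw [hobs, ← variance_map (hTm.aemeasurable) hΦ.aemeasurable, map_punctured_eq_pi ρ hL hρ x₀ β]
  -- independence: the variance of the sum is the sum of the one-plaquette variances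
  have hmem : ∀ _i : {x : Site 2 L // x ≠ x₀}, MemLp s 2 π₁ := fun _ =>
    MemLp.of_bound hs_cont.aestronglyMeasurable (2 * N) (ae_of_all _ fun g => by
      have h := hs_mem g
      rw [Real.norm_eq_abs, abs_le]; constructor <;> linarith [h.1, h.2])
  have hsum := variance_sum_pi (μ := fun _ : {x : Site 2 L // x ≠ x₀} => π₁)
    (X := fun _ : {x : Site 2 L // x ≠ x₀} => s) hmem
  rw [show (∑ i, fun ω : {x : Site 2 L // x ≠ x₀} → G => (fun _ : {x : Site 2 L // x ≠ x₀} => s) i (ω i))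
      = T from rfl] at hsum
  rw [hsum]
  -- Popoviciu per plaquette and counting
  have hvar1 : variance s π₁ ≤ (N : ℝ) ^ 2 := by
    have h := variance_le_sq_of_bounded (μ := π₁) (ae_of_all _ hs_mem) hs_cont.measurable.aemeasurable
    calc variance s π₁ ≤ ((2 * N - 0) / 2) ^ 2 := h
      _ = (N : ℝ) ^ 2 := by ring
  have hcard : (Fintype.card {x : Site 2 L // x ≠ x₀} : ℝ) ≤ (L : ℝ) ^ 2 - 1 := by
    have hlt : Fintype.card {x : Site 2 L // x ≠ x₀} < Fintype.card (Site 2 L) :=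
      Fintype.card_subtype_lt (p := fun x : Site 2 L => x ≠ x₀) (x := x₀) (not_not.2 rfl)
    have hS : Fintype.card (Site 2 L) = L ^ 2 := by
      rw [Fintype.card_fun, ZMod.card, Fintype.card_fin]
    rw [hS] at hlt
    have h' : (Fintype.card {x : Site 2 L // x ≠ x₀} : ℝ) + 1 ≤ ((L ^ 2 : ℕ) : ℝ) := by
      exact_mod_cast hlt
    push_cast at h'
    linarith
  calc ∑ _i : {x : Site 2 L // x ≠ x₀}, variance s π₁
      ≤ ∑ _i : {x : Site 2 L // x ≠ x₀}, (N : ℝ) ^ 2 := Finset.sum_le_sum fun i _ => hvar1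
    _ = Fintype.card {x : Site 2 L // x ≠ x₀} * (N : ℝ) ^ 2 := by
      rw [Finset.sum_const, Finset.card_univ, nsmul_eq_mul]
    _ ≤ ((L : ℝ) ^ 2 - 1) * (N : ℝ) ^ 2 := by gcongr

/-- **MAIN THEOREM — THE TWO-DIMENSIONAL SPECIFIC-HEAT CEILING, EVERY COMPACT GAUGE GROUP, EVERY
COUPLING**: on `(ℤ/L)²`, `L ≥ 2`, for every continuous representation `ρ : G →* M_N(ℂ)` of a compact
group and every real `β`, `Var_{μ_β}(S_W^ρ) ≤ 2N²·exp(2N|β|)·L²`. [ours] -/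
theorem wilson_variance_le_twoDim (hL : 2 ≤ L) (hρ : Continuous ρ) (β : ℝ) :
    variance (wilsonAction (d := 2) (L := L) ρ) (wilsonMeasure (d := 2) (L := L) ρ β) ≤
      2 * (N : ℝ) ^ 2 * exp (2 * N * |β|) * (L : ℝ) ^ 2 := by
  classical
  set s : G → ℝ := fun g => (N : ℝ) - (ρ g).trace.re with hs_def
  have hs_cont : Continuous s := continuous_plaqTerm ρ hρ
  have hs_abs : ∀ g, |s g - N| ≤ N := fun g => by
    have h := plaqTerm_mem_Icc ρ hρ g
    rw [abs_le]; constructor <;> linarith [h.1, h.2]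
  let x₀ : Site 2 L := 0
  -- the punctured action `S'`, the punctured measure `ν`, its mean `m`
  set S' : GaugeConfig 2 L G → ℝ := fun U => ∑ i : {x : Site 2 L // x ≠ x₀},
      ((N : ℝ) - (ρ (plaquetteHolonomy U i.1 0 1)).trace.re) with hS'
  set ν : Measure (GaugeConfig 2 L G) := (trivialMeasure G 2 L).tilted fun U =>
      ∑ i : {x : Site 2 L // x ≠ x₀}, -(β * ((N : ℝ) - (ρ (plaquetteHolonomy U i.1 0 1)).trace.re))
    with hν
  have hS'c : Continuous S' :=
    continuous_finsetSum _ fun i _ => (continuous_plaqTerm ρ hρ).comp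
      ((continuous_apply i).comp (continuous_holonomies_ne (G := G) x₀))
  have hνc : Continuous fun U : GaugeConfig 2 L G => ∑ i : {x : Site 2 L // x ≠ x₀},
      -(β * ((N : ℝ) - (ρ (plaquetteHolonomy U i.1 0 1)).trace.re)) :=
    continuous_finsetSum _ fun i _ => (continuous_const.mul ((continuous_plaqTerm ρ hρ).comp
      ((continuous_apply i).comp (continuous_holonomies_ne (G := G) x₀)))).neg
  haveI : IsProbabilityMeasure (trivialMeasure G 2 L) := trivialMeasure_isProbabilityMeasure
  haveI : IsProbabilityMeasure ν :=
    isProbabilityMeasure_tilted (integrable_trivialMeasure_of_continuous_group (continuous_exp.comp hνc))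
  haveI := isProbabilityMeasure_wilsonMeasure (d := 2) (L := L) ρ hρ β
  set m : ℝ := ∫ U, S' U ∂ν with hm
  have hSc : Continuous (wilsonAction (d := 2) (L := L) ρ) := continuous_wilsonAction_of_continuous ρ hρ
  have hhol₀c : Continuous fun U : GaugeConfig 2 L G => plaquetteHolonomy U x₀ 0 1 := by
    unfold plaquetteHolonomy; fun_prop
  -- pointwise: `(S_W − (m+N))² ≤ 2 (S' − m)² + 2N²`
  have hpt : ∀ U : GaugeConfig 2 L G,
      (wilsonAction ρ U - (m + N)) ^ 2 ≤ 2 * (S' U - m) ^ 2 + 2 * (N : ℝ) ^ 2 := by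
    intro U
    have hb := hs_abs (plaquetteHolonomy U x₀ 0 1)
    have hb2 : (s (plaquetteHolonomy U x₀ 0 1) - N) ^ 2 ≤ (N : ℝ) ^ 2 := by
      rw [← sq_abs]
      exact pow_le_pow_left₀ (abs_nonneg _) hb 2
    have hdec : wilsonAction ρ U - (m + N) =
        (S' U - m) + (s (plaquetteHolonomy U x₀ 0 1) - N) := by
      rw [wilsonAction_two_eq_add_sum_ne ρ x₀ U]; ring
    rw [hdec]
    calc (S' U - m + (s (plaquetteHolonomy U x₀ 0 1) - N)) ^ 2
        = 2 * (S' U - m) ^ 2 + 2 * (s (plaquetteHolonomy U x₀ 0 1) - N) ^ 2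
            - ((S' U - m) - (s (plaquetteHolonomy U x₀ 0 1) - N)) ^ 2 := by ring
      _ ≤ 2 * (S' U - m) ^ 2 + 2 * (s (plaquetteHolonomy U x₀ 0 1) - N) ^ 2 :=
            sub_le_self _ (sq_nonneg _)
      _ ≤ 2 * (S' U - m) ^ 2 + 2 * (N : ℝ) ^ 2 := by linarith [hb2]
  have hint_sqν : Integrable (fun U => (S' U - m) ^ 2) ν :=
    integrable_of_continuous_compactSpace ν ((hS'c.sub continuous_const).pow 2)
  have hint_sqμ : Integrable (fun U => (S' U - m) ^ 2) (wilsonMeasure (d := 2) (L := L) ρ β) :=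
    integrable_of_continuous_compactSpace _ ((hS'c.sub continuous_const).pow 2)
  have hint_S : Integrable (fun U => (wilsonAction ρ U - (m + N)) ^ 2)
      (wilsonMeasure (d := 2) (L := L) ρ β) :=
    integrable_of_continuous_compactSpace _ ((hSc.sub continuous_const).pow 2)
  -- the transfer `∫ (S' − m)² dμ_β ≤ e^{2N|β|} Var_ν(S') ≤ e^{2N|β|} (L² − 1) N²`
  have htrans : ∫ U, (S' U - m) ^ 2 ∂(wilsonMeasure (d := 2) (L := L) ρ β) ≤
      exp (2 * (N * |β|)) * (((L : ℝ) ^ 2 - 1) * (N : ℝ) ^ 2) := by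
    rw [wilsonMeasure_two_eq_tilted_punctured ρ hρ x₀ β, ← hν]
    have hK : ∀ U : GaugeConfig 2 L G,
        |-(β * ((N : ℝ) - (ρ (plaquetteHolonomy U x₀ 0 1)).trace.re)) - (-(β * N))| ≤ N * |β| := by
      intro U
      have : -(β * ((N : ℝ) - (ρ (plaquetteHolonomy U x₀ 0 1)).trace.re)) - (-(β * N)) =
          -(β * (s (plaquetteHolonomy U x₀ 0 1) - N)) := by simp only [hs_def]; ring
      rw [this, abs_neg, abs_mul, mul_comm]
      exact mul_le_mul_of_nonneg_right (hs_abs _) (abs_nonneg β)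
    have h1 := integral_tilted_le_exp_osc_mul (μ := ν)
      ((continuous_const.mul ((continuous_plaqTerm ρ hρ).comp hhol₀c)).neg.measurable) hK
      (fun U => sq_nonneg _) hint_sqν
    refine h1.trans ?_
    have hv : ∫ U, (S' U - m) ^ 2 ∂ν = variance S' ν := by
      rw [variance_eq_integral hS'c.measurable.aemeasurable]
    rw [hv]
    gcongr
    exact variance_punctured_le ρ hL hρ x₀ β
  -- conclude
  have h1 : variance (wilsonAction (d := 2) (L := L) ρ) (wilsonMeasure (d := 2) (L := L) ρ β)
      = variance (fun U => wilsonAction (d := 2) (L := L) ρ U - (m + N))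
          (wilsonMeasure (d := 2) (L := L) ρ β) :=
    (variance_sub_const hSc.aestronglyMeasurable _).symm
  have h2 : variance (fun U => wilsonAction (d := 2) (L := L) ρ U - (m + N))
          (wilsonMeasure (d := 2) (L := L) ρ β)
      ≤ ∫ U, (wilsonAction ρ U - (m + N)) ^ 2 ∂(wilsonMeasure (d := 2) (L := L) ρ β) := by
    have h := variance_le_expectation_sq (μ := wilsonMeasure (d := 2) (L := L) ρ β)
      (X := fun U => wilsonAction (d := 2) (L := L) ρ U - (m + N))
      (hSc.sub continuous_const).aestronglyMeasurable
    simpa only [Pi.pow_apply] using h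
  have h3 : ∫ U, (wilsonAction ρ U - (m + N)) ^ 2 ∂(wilsonMeasure (d := 2) (L := L) ρ β)
      ≤ ∫ U, (2 * (S' U - m) ^ 2 + 2 * (N : ℝ) ^ 2) ∂(wilsonMeasure (d := 2) (L := L) ρ β) :=
    integral_mono hint_S ((hint_sqμ.const_mul 2).add (integrable_const _)) hpt
  have h4 : ∫ U, (2 * (S' U - m) ^ 2 + 2 * (N : ℝ) ^ 2) ∂(wilsonMeasure (d := 2) (L := L) ρ β)
      = 2 * ∫ U, (S' U - m) ^ 2 ∂(wilsonMeasure (d := 2) (L := L) ρ β) + 2 * (N : ℝ) ^ 2 := by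
    rw [integral_add (hint_sqμ.const_mul 2) (integrable_const _), integral_const_mul,
      integral_const, probReal_univ, one_smul]
  have hexp1 : 1 ≤ exp (2 * (N * |β|)) := one_le_exp (by positivity)
  have h6 : (N : ℝ) ^ 2 ≤ (N : ℝ) ^ 2 * exp (2 * (N * |β|)) :=
    le_mul_of_one_le_right (sq_nonneg _) hexp1
  have h7 : 2 * (exp (2 * (N * |β|)) * (((L : ℝ) ^ 2 - 1) * (N : ℝ) ^ 2)) + 2 * (N : ℝ) ^ 2
      = 2 * (N : ℝ) ^ 2 * exp (2 * N * |β|) * (L : ℝ) ^ 2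
        - 2 * ((N : ℝ) ^ 2 * exp (2 * (N * |β|)) - (N : ℝ) ^ 2) := by
    rw [show 2 * (N : ℝ) * |β| = 2 * (N * |β|) by ring]
    ring
  rw [h1]
  linarith [h2, h3, h4, htrans, h6, h7]

/-- The same ceiling in the `#plaquettes` normalisation of the coupling-transfer laws
(`#plaq((ℤ/L)²) = L²`): `Var_{μ_β}(S_W^ρ) ≤ 2N²·exp(2N|β|)·#plaq`. [ours] -/
theorem wilson_variance_le_twoDim_card (hL : 2 ≤ L) (hρ : Continuous ρ) (β : ℝ) :
    variance (wilsonAction (d := 2) (L := L) ρ) (wilsonMeasure (d := 2) (L := L) ρ β) ≤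
      2 * (N : ℝ) ^ 2 * exp (2 * N * |β|) * Fintype.card (Plaquette 2 L) := by
  have hcard : (Fintype.card (Plaquette 2 L) : ℝ) = (L : ℝ) ^ 2 := by
    have h1 : Fintype.card {p : Fin 2 × Fin 2 // p.1 < p.2} = 1 := by
      rw [Fintype.card_eq_one_iff]
      exact ⟨⟨((0 : Fin 2), (1 : Fin 2)), by decide⟩, fun p => plane_eq_zero_one p⟩
    rw [Fintype.card_prod, h1, Fintype.card_fun, ZMod.card, Fintype.card_fin]
    push_cast
    ring
  rw [hcard]
  exact wilson_variance_le_twoDim ρ hL hρ β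

end TwoDim

end Summit.Ventures.LatticeQCDFlow.TrivializingMaps

end
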